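import Literature.AlgebraicGeometry.HodgeTheory.BettiHodgeConjectureProductOfSurfacesOddKunneth
import HarnessLib

/-!
# `HC(S × T)` for a surface and a threefold reduces to the pieces `H¹(S) ⊗ H³(T)` and `H²(S) ⊗ H²(T)`: the piece `H³(S) ⊗ H¹(T)` is algebraic (hard Lefschetz on `S` + Lefschetz `(1,1)`,
# modulo Fulton's pull-back lemma), so `HC(S × T)` holds when `Hom_HS(H¹(S), H³(T)(1)) = 0` and `dim Hom_HS(H²S, H²T) ≤ ρ(S)ρ(T)` — in particular when `Hom_HS(H¹(S), H³(T)(1)) = 0` and `p_g(S) = 0`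
# or `h^{2,0}(T) = 0` (Voisin I Thm. 11.38–11.40, Lemma 11.41, Thm. 6.25, Thm. 11.30; Deligne 2000 §1)

Family `hodge`, lane `lit-hodgefound` (Track 2 foundations library; Layers A2/A4), layer `Literature/AlgebraicGeometry/HodgeTheory`.  THEOREMS ONLY (no definition, no named fact, no instance;
D-0026 net debt `0`); the cup-product step is modulo the tree's named fact `fulton1998_map_mem_algebraicClasses` (hypothesis `hF`), as in the seat's g28-#7.  Sequel of g28-#7
(`BettiHodgeConjectureProductOfSurfacesOddKunneth`: the Hodge classes of `H³(S) ⊗ H¹(Z)` are algebraic for a surface `S` and ANY smooth projective `Z`) and of g27-#11 / g28-#1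
(`hodgeConjectureFor_surface_tensor_threefold_of_hom(_of_hardLefschetz)`: `HC(S ⊗ T)` under THREE conditions `Hom_HS(H¹S, H¹T) = 0`, `Hom_HS(H¹S, H³T(1)) = 0`, `dim Hom_HS(H²S, H²T) ≤ ρ(S)ρ(T)`).
Here the first condition is REMOVED (granted `hF`): for the fivefold `S × T`, `HC ⟺ HC²` (codimensions `0, 1, 4, 5` free and `HC³ ⟺ HC²` by hard Lefschetz, the tree's
`hodgeConjectureFor_iff_codim_two_of_dim_eq_five`), and the Künneth pieces of `H⁴(S × T)` are `H⁰(S) ⊗ H⁴(T)` (Hodge classes `= H⁰ ⊗ Hdg²(H⁴T)`, algebraic: codimension `2 = dim T − 1`),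
`H¹(S) ⊗ H³(T)` (CONDITION: no morphism `H¹(S) → H³(T)(1)`), `H²(S) ⊗ H²(T)` (CONDITION: spanned by products of divisor classes), `H³(S) ⊗ H¹(T)` (ALGEBRAIC, g28-#7 §2) and `H⁴(S) ⊗ H⁰(T)`
(algebraic).

THE PRINTS.  C. Voisin (2002) [VoisinHodgeI2002] §11.3.3 Thm. 11.38, Thm. 11.40, Lemma 11.41 (p. 286), p. 287; §6.2.3 Thm. 6.25, Rem. 6.27; §11.3.1 Thm. 11.30; §11.3.2.  P. Deligne (2000)
[Deligne2000] §1.  W. Fulton (1998) [Fulton1998] §19.1 Prop. 19.1.2, Cor. 19.2 (b).  P. Deligne (1971) [DeligneHodgeII1971] 2.1.13 (pure type), 1.1.12.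

THE OBJECTS (all the tree's).  `S T : SchemeOver ℂ`, `hS : IsSmoothProjective 2 S`, `hT : IsSmoothProjective 3 T`, `hST : IsSmoothProjective 5 (S ⊗ T)`; the Künneth summands
`BettiUniverse.kunnethSummand hHD hS hT (2·2) ⟨(i, j), _⟩` and cross products `BettiUniverse.crossMap`; `Hom_HS`, Tate twists `tateTwist`, `cast`; `ρ(X) = dim_ℚ Hdg¹(H²(X))`, `p_g(S) = h^{2,0}(H²(S))`,
`h^{2,0}(T) = (BettiUniverse.hodge hHD hT 2).hodgeNumber 2 0`; `hF : fulton1998_map_mem_algebraicClasses`.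

WHAT IS PROVED (all granted `hF`).
* **`HC(S ⊗ T)` as soon as the Hodge classes of the pieces `H¹(S) ⊗ H³(T)` and `H²(S) ⊗ H²(T)` map to algebraic classes** (`BettiUniverse.hodgeConjectureFor_surface_tensor_threefold_of_kunneth_pieces`).
* **`HC(S ⊗ T)` if `Hom_HS(H¹(S), H³(T)(1)) = 0` and `dim_ℚ Hom_HS(H²(S), H²(T)) ≤ ρ(S)ρ(T)`** (`BettiUniverse.hodgeConjectureFor_surface_tensor_threefold_of_hom_of_fulton` — g27-#11/g28-#1 without the
  `H¹ ⊗ H¹`-condition).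
* **`HC(S ⊗ T)` if `Hom_HS(H¹(S), H³(T)(1)) = 0` and `p_g(S) = 0`** (`…_of_pg_zero_of_hom_of_fulton`), or `Hom_HS(H¹(S), H³(T)(1)) = 0` and `h^{2,0}(T) = 0` (`…_of_h20_zero_of_hom_of_fulton`).
* The `…_of_cupProduct` forms (only hypothesis: the cup-closure of the divisor classes of `S × T`), hence UNCONDITIONALLY for an abelian surface `A` and an abelian threefold `B`:
  **`HC(A × B)` if `Hom_HS(H¹(A), H³(B)(1)) = 0` and `dim_ℚ Hom_HS(H²(A), H²(B)) ≤ ρ(A)ρ(B)`** (`AbelianVariety.hodgeConjectureFor_prod_surface_threefold_of_hom`, via the tree's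
  `AbelianVariety.cupProduct_mem_algebraicClasses`).

DEVIATIONS / SCOPE.  The remaining conditions concern the pieces `H¹(S) ⊗ H³(T)` (morphisms `H¹(S)(−1) → H³(T)`, e.g. into the intermediate-Jacobian part of `T`) and the transcendental part of
`H²(S) ⊗ H²(T)`; neither is touched here.  Related print, not formalized: for products of SURFACES with `p_g = 1`, `q = 2` (e.g. two abelian surfaces) the full Hodge conjecture is
[cite: RamonMari2008, Thm. 2.14]; the abelian case below (`A` a surface, `B` a threefold) keeps its two Hodge-theoretic conditions.

## References
* [VoisinHodgeI2002] C. Voisin, *Hodge Theory and Complex Algebraic Geometry I* (2002) — §11.3.3 Thm. 11.38, Thm. 11.40, Lemma 11.41 (pp. 285–287); §6.2.3 Thm. 6.25, Rem. 6.27; §11.3.1 Thm. 11.30; §11.3.2.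
* [Deligne2000] P. Deligne, *The Hodge conjecture* (Clay, 2000) — §1.
* [Fulton1998] W. Fulton, *Intersection Theory*, 2nd ed. (1998) — §19.1 Prop. 19.1.2; Cor. 19.2 (b).
* [DeligneHodgeII1971] P. Deligne, *Théorie de Hodge II* (1971) — 1.1.12; 2.1.13.
* [VoisinHodgeII2003] C. Voisin, *Hodge Theory and Complex Algebraic Geometry II* (2003) — §9.2.2 Prop. 9.20–9.21.
* [RamonMari2008] J. J. Ramón Marí, *On the Hodge conjecture for products of certain surfaces*, Collect. Math. 59 (2008) 1–26 — Thm. 2.14 (related print).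

## Provenance
Lane `lit-hodgefound` (Hodge path, Track 2), prover seat `lit-hodgefound-p29` (generation 28), self-proposed row g28-#8 (corollary file of g28-#7 for `S × T`); revision g28-#10 (same seat): the
`…_of_cupProduct` forms and the unconditional abelian case.
-/

noncomputable section

open scoped TensorProduct
open CategoryTheory MonoidalCategory CartesianMonoidalCategory Module Finset
open Literature.AlgebraicTopology.SingularHomology
open Literature.Geometry.Kaehler

namespace Literature.AlgebraicGeometry.HodgeTheory

open Literature.AlgebraicGeometry.Motives
open Literature.AlgebraicGeometry.Motives.HodgeStructure

variable {S T : SchemeOver ℂ}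

/-- The piece `H⁰(S) ⊗ H⁴(T)`: its Hodge classes are `H⁰(S) ⊗ Hdg²(H⁴(T))` (`H⁰` is of pure type `(0,0)`, Deligne 2.1.13), cross products of the fundamental class with the algebraic classes of
codimension `2 = dim T − 1` on `T`. [cite: VoisinHodgeI2002, §11.3.3 p. 287, Thm. 11.30 and §6.2.3 Thm. 6.25] [cite: DeligneHodgeII1971, 2.1.13] [cite: Deligne2000, §1] -/
private theorem ofRatClass_crossMap_mem_algebraicClasses_zero_four [HodgeTensorFacts.{0, 0}] (hHD : exists_isReal_hodgeModel) (hS : IsSmoothProjective 2 S) (hT : IsSmoothProjective 3 T)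
    {t : bettiCohomology S 0 ⊗[ℚ] bettiCohomology T 4} (ht : t ∈ (BettiUniverse.kunnethSummand hHD hS hT (2 * 2) ⟨(0, 4), HasAntidiagonal.mem_antidiagonal.2 rfl⟩).hodgeClasses 2) :
    ofRatClass (ComplexPoints (S ⊗ T)) (2 * 2) (BettiUniverse.crossMap S T (show 0 + 4 = 2 * 2 by norm_num) t) ∈ algebraicClasses (S ⊗ T) 2 := by
  haveI := BettiUniverse.finite hS 0
  haveI := BettiUniverse.finite hT 4
  have e0 : (BettiUniverse.hodge hHD hS (2 * 0)).hodgeClasses ((0 : ℕ) : ℤ) = ⊤ := BettiUniverse.hodgeClasses_hodge_zero_eq_top hHD hS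
  have hspan := HodgeStructure.hodgeClasses_tensor_eq_span_of_hodgeClasses_eq_top (BettiUniverse.hodge hHD hS 0) (a := 0) e0 (by norm_num) (BettiUniverse.hodge hHD hT 4) 2
  rw [zero_add] at hspan
  have hle : Submodule.span ℚ (Set.image2 (fun u w ↦ u ⊗ₜ[ℚ] w) Set.univ (((BettiUniverse.hodge hHD hT 4).hodgeClasses 2 : Set (bettiCohomology T 4)))) ≤
      LinearMap.range (TensorProduct.mapIncl (⊤ : Submodule ℚ (bettiCohomology S 0)) ((BettiUniverse.hodge hHD hT 4).hodgeClasses 2)) :=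
    Submodule.span_le.2 (by
      rintro _ ⟨u, -, w, hw, rfl⟩
      exact ⟨(⟨u, Submodule.mem_top⟩ : ↥(⊤ : Submodule ℚ (bettiCohomology S 0))) ⊗ₜ[ℚ] (⟨w, hw⟩ : ↥((BettiUniverse.hodge hHD hT 4).hodgeClasses 2)),
        by rw [TensorProduct.mapIncl, TensorProduct.map_tmul]; rfl⟩)
  have ht' : t ∈ LinearMap.range (TensorProduct.mapIncl (⊤ : Submodule ℚ (bettiCohomology S 0)) ((BettiUniverse.hodge hHD hT 4).hodgeClasses 2)) := by
    refine hle ?_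
    rw [← hspan]
    change t ∈ ((BettiUniverse.hodge hHD hS 0).tensor (BettiUniverse.hodge hHD hT 4)).hodgeClasses 2 at ht
    exact ht
  obtain ⟨w, rfl⟩ := ht'
  clear ht
  induction w using TensorProduct.induction_on with
  | zero => rw [map_zero, map_zero, map_zero]; exact Submodule.zero_mem _
  | tmul p q =>
    rw [TensorProduct.mapIncl, TensorProduct.map_tmul, Submodule.subtype_apply, Submodule.subtype_apply]
    have hp : (p : bettiCohomology S 0) ∈ (BettiUniverse.hodge hHD hS (2 * 0)).hodgeClasses ((0 : ℕ) : ℤ) := by rw [e0]; exact Submodule.mem_top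
    have hq : (q : bettiCohomology T 4) ∈ (BettiUniverse.hodge hHD hT (2 * 2)).hodgeClasses ((2 : ℕ) : ℤ) := q.2
    have hpq := BettiUniverse.ofRatClass_crossMap_tmul_mem_algebraicClasses hS hT
      ((BettiUniverse.mem_hodgeClasses_hodge_iff_ofRatClass_mem_algebraicClasses hHD hS (p := 0) (Or.inl (by norm_num)) _).1 hp)
      ((BettiUniverse.mem_hodgeClasses_hodge_iff_ofRatClass_mem_algebraicClasses hHD hT (p := 2) (Or.inr (by norm_num)) _).1 hq)
    exact hpq
  | add x y hx hy => rw [map_add, map_add, map_add]; exact Submodule.add_mem _ hx hy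

/-- The piece `H⁴(S) ⊗ H⁰(T)`: every class is a sum of cross products of the point class of `S` with classes of `H⁰(T)`, all algebraic. [cite: VoisinHodgeI2002, §11.3.3 p. 287 and Thm. 11.30] [cite: Deligne2000, §1] -/
private theorem ofRatClass_crossMap_mem_algebraicClasses_four_zero [HodgeTensorFacts.{0, 0}] (hHD : exists_isReal_hodgeModel) (hS : IsSmoothProjective 2 S) (hT : IsSmoothProjective 3 T)
    (t : bettiCohomology S 4 ⊗[ℚ] bettiCohomology T 0) :
    ofRatClass (ComplexPoints (S ⊗ T)) (2 * 2) (BettiUniverse.crossMap S T (show 4 + 0 = 2 * 2 by norm_num) t) ∈ algebraicClasses (S ⊗ T) 2 := by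
  induction t using TensorProduct.induction_on with
  | zero => rw [map_zero, map_zero]; exact Submodule.zero_mem _
  | tmul w e =>
    have e4 : (BettiUniverse.hodge hHD hS (2 * 2)).hodgeClasses ((2 : ℕ) : ℤ) = ⊤ := BettiUniverse.hodgeClasses_hodge_top_eq_top hHD hS
    have e0 : (BettiUniverse.hodge hHD hT (2 * 0)).hodgeClasses ((0 : ℕ) : ℤ) = ⊤ := BettiUniverse.hodgeClasses_hodge_zero_eq_top hHD hT
    have hw : ofRatClass (ComplexPoints S) (2 * 2) w ∈ algebraicClasses S 2 :=
      (BettiUniverse.mem_hodgeClasses_hodge_iff_ofRatClass_mem_algebraicClasses hHD hS (p := 2) (Or.inr (by norm_num)) w).1 (by rw [e4]; exact Submodule.mem_top)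
    have he : ofRatClass (ComplexPoints T) (2 * 0) e ∈ algebraicClasses T 0 :=
      (BettiUniverse.mem_hodgeClasses_hodge_iff_ofRatClass_mem_algebraicClasses hHD hT (p := 0) (Or.inl (by norm_num)) e).1 (by rw [e0]; exact Submodule.mem_top)
    have halg := BettiUniverse.ofRatClass_crossMap_tmul_mem_algebraicClasses hS hT hw he
    exact halg
  | add x y hx hy => rw [map_add, map_add]; exact Submodule.add_mem _ hx hy

/-- **`HC(S ⊗ T)` (`S` a surface, `T` a threefold; granted the cup-closure `hcup` of the divisor classes of `S × T`) as soon as the Hodge classes of the Künneth pieces `H¹(S) ⊗ H³(T)` and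
`H²(S) ⊗ H²(T)` of `H⁴(S × T)` map to algebraic classes**: `HC(S ⊗ T) ⟺ HC²(S ⊗ T)` (fivefold), the Hodge classes of `H⁴(S × T)` are sums of cross products of Hodge classes of the five pieces (Thm. 11.38/11.40), and the pieces
`H⁰⊗H⁴`, `H³⊗H¹` (g28-#7), `H⁴⊗H⁰` are algebraic. [cite: VoisinHodgeI2002, §11.3.3 Thm. 11.38, Thm. 11.40, Lemma 11.41 and p. 287, §11.3.1 Thm. 11.30, §6.2.3 Thm. 6.25] [cite: Deligne2000, §1]
[cite: Fulton1998, §19.1 Prop. 19.1.2 and Cor. 19.2 (b)] -/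
theorem BettiUniverse.hodgeConjectureFor_surface_tensor_threefold_of_kunneth_pieces_of_cupProduct [HodgeTensorFacts.{0, 0}] (hHD : exists_isReal_hodgeModel)
    (hS : IsSmoothProjective 2 S) (hT : IsSmoothProjective 3 T) (hST : IsSmoothProjective 5 (S ⊗ T))
    (hcup : ∀ ⦃x y : complexBetti (S ⊗ T) (2 * 1)⦄, x ∈ algebraicClasses (S ⊗ T) 1 → y ∈ algebraicClasses (S ⊗ T) 1 →
      cupProduct (two_mul_add_two_mul 1 1) x y ∈ algebraicClasses (S ⊗ T) (1 + 1))
    (h13 : ∀ t ∈ (BettiUniverse.kunnethSummand hHD hS hT (2 * 2) ⟨(1, 3), HasAntidiagonal.mem_antidiagonal.2 rfl⟩).hodgeClasses 2,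
      ofRatClass (ComplexPoints (S ⊗ T)) (2 * 2) (BettiUniverse.crossMap S T (show 1 + 3 = 2 * 2 by norm_num) t) ∈ algebraicClasses (S ⊗ T) 2)
    (h22 : ∀ t ∈ (BettiUniverse.kunnethSummand hHD hS hT (2 * 2) ⟨(2, 2), HasAntidiagonal.mem_antidiagonal.2 rfl⟩).hodgeClasses 2,
      ofRatClass (ComplexPoints (S ⊗ T)) (2 * 2) (BettiUniverse.crossMap S T (show 2 + 2 = 2 * 2 by norm_num) t) ∈ algebraicClasses (S ⊗ T) 2) :
    HodgeConjectureFor 5 (S ⊗ T) := by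
  refine (hodgeConjectureFor_iff_codim_two_of_dim_eq_five hST).2 fun c hc hcH ↦ ?_
  obtain ⟨v, rfl⟩ := (isRationalClass_iff_mem_range_ofRatClass c).1 hc
  have hv : v ∈ (BettiUniverse.hodge hHD hST (2 * 2)).hodgeClasses 2 := (BettiUniverse.mem_hodgeClasses_hodge_iff_isOfHodgeType hHD hST 2 v).2 hcH
  obtain ⟨t, ⟨ht, rfl⟩, -⟩ := BettiUniverse.exists_eq_kunnethMap_of_mem_hodgeClasses hHD hodgePQ_independent_of_hodgeModel_holds hS hT hST (2 * 2) 2 hv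
  rw [map_sum]
  refine Submodule.sum_mem _ fun ij _ ↦ ?_
  obtain ⟨⟨i, j⟩, hij⟩ := ij
  have hij' : i + j = 4 := HasAntidiagonal.mem_antidiagonal.1 hij
  have hcases : i = 0 ∧ j = 4 ∨ i = 1 ∧ j = 3 ∨ i = 2 ∧ j = 2 ∨ i = 3 ∧ j = 1 ∨ i = 4 ∧ j = 0 := by omega
  rcases hcases with ⟨rfl, rfl⟩ | ⟨rfl, rfl⟩ | ⟨rfl, rfl⟩ | ⟨rfl, rfl⟩ | ⟨rfl, rfl⟩
  · have h04 := ofRatClass_crossMap_mem_algebraicClasses_zero_four hHD hS hT (ht ⟨(0, 4), hij⟩)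
    exact h04
  · have h := h13 _ (ht ⟨(1, 3), hij⟩)
    exact h
  · have h := h22 _ (ht ⟨(2, 2), hij⟩)
    exact h
  · have h31 := BettiUniverse.ofRatClass_crossMap_mem_algebraicClasses_of_hodge_three_tensor_one_of_cupProduct hHD hS hT hST hcup (ht ⟨(3, 1), hij⟩)
    exact h31
  · have h40 := ofRatClass_crossMap_mem_algebraicClasses_four_zero hHD hS hT (t ⟨(4, 0), hij⟩)
    exact h40

/-- **`HC(S ⊗ T)` (`S` a surface, `T` a threefold; granted Fulton's pull-back lemma `hF`) as soon as the Hodge classes of the Künneth pieces `H¹(S) ⊗ H³(T)` and `H²(S) ⊗ H²(T)` of `H⁴(S × T)` map to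
algebraic classes.** [cite: VoisinHodgeI2002, §11.3.3 Thm. 11.38, Thm. 11.40, Lemma 11.41 and p. 287, §11.3.1 Thm. 11.30, §6.2.3 Thm. 6.25] [cite: Deligne2000, §1] [cite: Fulton1998, §19.1 Prop. 19.1.2 and Cor. 19.2 (b)] -/
theorem BettiUniverse.hodgeConjectureFor_surface_tensor_threefold_of_kunneth_pieces [HodgeTensorFacts.{0, 0}] (hF : fulton1998_map_mem_algebraicClasses) (hHD : exists_isReal_hodgeModel)
    (hS : IsSmoothProjective 2 S) (hT : IsSmoothProjective 3 T) (hST : IsSmoothProjective 5 (S ⊗ T))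
    (h13 : ∀ t ∈ (BettiUniverse.kunnethSummand hHD hS hT (2 * 2) ⟨(1, 3), HasAntidiagonal.mem_antidiagonal.2 rfl⟩).hodgeClasses 2,
      ofRatClass (ComplexPoints (S ⊗ T)) (2 * 2) (BettiUniverse.crossMap S T (show 1 + 3 = 2 * 2 by norm_num) t) ∈ algebraicClasses (S ⊗ T) 2)
    (h22 : ∀ t ∈ (BettiUniverse.kunnethSummand hHD hS hT (2 * 2) ⟨(2, 2), HasAntidiagonal.mem_antidiagonal.2 rfl⟩).hodgeClasses 2,
      ofRatClass (ComplexPoints (S ⊗ T)) (2 * 2) (BettiUniverse.crossMap S T (show 2 + 2 = 2 * 2 by norm_num) t) ∈ algebraicClasses (S ⊗ T) 2) :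
    HodgeConjectureFor 5 (S ⊗ T) :=
  BettiUniverse.hodgeConjectureFor_surface_tensor_threefold_of_kunneth_pieces_of_cupProduct hHD hS hT hST (fun _ _ hx hy ↦ cupProduct_algebraicClasses_of_fulton1998 hF hST hx hy) h13 h22

/-- **`HC(S ⊗ T)` for a surface `S` and a threefold `T` with `Hom_HS(H¹(S), H³(T)(1)) = 0` and `dim_ℚ Hom_HS(H²(S), H²(T)) ≤ ρ(S)ρ(T)`, granted the cup-closure `hcup` of the divisor classes of
`S × T`** — the seat's g27-#11 / g28-#1 theorem
`hodgeConjectureFor_surface_tensor_threefold_of_hom(_of_hardLefschetz)` WITHOUT its condition `Hom_HS(H¹S, H¹T) = 0`: the piece `H¹(S) ⊗ H³(T)` has no Hodge class at all (Lemma 11.41 with a twist,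
g27-#7), the Hodge classes of `H²(S) ⊗ H²(T)` are spanned by the products of divisor classes. [cite: VoisinHodgeI2002, §11.3.3 Lemma 11.41, p. 287, Thm. 11.30 and §6.2.3 Thm. 6.25] [cite: Deligne2000, §1]
[cite: Fulton1998, §19.1 Prop. 19.1.2 and Cor. 19.2 (b)] -/
theorem BettiUniverse.hodgeConjectureFor_surface_tensor_threefold_of_hom_of_cupProduct (hHD : exists_isReal_hodgeModel) (hS : IsSmoothProjective 2 S) (hT : IsSmoothProjective 3 T)
    (hST : IsSmoothProjective 5 (S ⊗ T))
    (hcup : ∀ ⦃x y : complexBetti (S ⊗ T) (2 * 1)⦄, x ∈ algebraicClasses (S ⊗ T) 1 → y ∈ algebraicClasses (S ⊗ T) 1 →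
      cupProduct (two_mul_add_two_mul 1 1) x y ∈ algebraicClasses (S ⊗ T) (1 + 1))
    (h13 : Subsingleton (HodgeStructure.Hom (BettiUniverse.hodge hHD hS 1) (((BettiUniverse.hodge hHD hT 3).tateTwist 1).cast (by norm_num))))
    (h22 : Module.finrank ℚ (HodgeStructure.Hom (BettiUniverse.hodge hHD hS 2) (BettiUniverse.hodge hHD hT 2)) ≤
      Module.finrank ℚ ↥((BettiUniverse.hodge hHD hS 2).hodgeClasses 1) * Module.finrank ℚ ↥((BettiUniverse.hodge hHD hT 2).hodgeClasses 1)) :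
    HodgeConjectureFor 5 (S ⊗ T) := by
  haveI : HodgeTensorFacts.{0, 0} := hodgeTensorFacts_holds
  haveI := BettiUniverse.finite hS 1
  haveI := BettiUniverse.finite hS 2
  haveI := BettiUniverse.finite hT 2
  haveI := BettiUniverse.finite hT 3
  refine BettiUniverse.hodgeConjectureFor_surface_tensor_threefold_of_kunneth_pieces_of_cupProduct hHD hS hT hST hcup (fun t ht ↦ ?_) (fun t ht ↦ ?_)
  · -- the piece `H¹(S) ⊗ H³(T)` has no Hodge classes
    have hz : Module.finrank ℚ ↥(((BettiUniverse.hodge hHD hS 1).tensor (BettiUniverse.hodge hHD hT 3)).hodgeClasses (((1 : ℕ) : ℤ) + 1)) = 0 := by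
      rw [BettiUniverse.finrank_hodgeClasses_tensor_hodge_eq_finrank_hom_tateTwist hHD hS hT 1 3 (s := 1) (by norm_num)]
      exact Module.finrank_zero_of_subsingleton
    have hbot := Submodule.finrank_eq_zero.1 hz
    change t ∈ ((BettiUniverse.hodge hHD hS 1).tensor (BettiUniverse.hodge hHD hT 3)).hodgeClasses 2 at ht
    rw [show (2 : ℤ) = ((1 : ℕ) : ℤ) + 1 by norm_num, hbot, Submodule.mem_bot] at ht
    rw [ht, map_zero, map_zero]
    exact Submodule.zero_mem _
  · -- the piece `H²(S) ⊗ H²(T)` is spanned by products of divisor classes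
    set P : Submodule ℚ (bettiCohomology S 2 ⊗[ℚ] bettiCohomology T 2) :=
      LinearMap.range (TensorProduct.mapIncl ((BettiUniverse.hodge hHD hS 2).hodgeClasses 1) ((BettiUniverse.hodge hHD hT 2).hodgeClasses 1)) with hP
    have hPle : P ≤ ((BettiUniverse.hodge hHD hS 2).tensor (BettiUniverse.hodge hHD hT 2)).hodgeClasses (1 + 1) := by
      rw [hP, TensorProduct.range_mapIncl, Submodule.map₂_le]
      exact fun y hy z hz ↦ HodgeStructure.tmul_mem_hodgeClasses_tensor _ _ hy hz
    haveI : Module.Free ℚ ↥((BettiUniverse.hodge hHD hS 2).hodgeClasses 1) := Module.Free.of_divisionRing ℚ _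
    haveI : Module.Free ℚ ↥((BettiUniverse.hodge hHD hT 2).hodgeClasses 1) := Module.Free.of_divisionRing ℚ _
    have hPrank : Module.finrank ℚ ↥P = Module.finrank ℚ ↥((BettiUniverse.hodge hHD hS 2).hodgeClasses 1) * Module.finrank ℚ ↥((BettiUniverse.hodge hHD hT 2).hodgeClasses 1) := by
      rw [hP, LinearMap.finrank_range_of_inj (Module.Flat.tensorProduct_mapIncl_injective_of_right _ _), Module.finrank_tensorProduct]
    have hHrank : Module.finrank ℚ ↥(((BettiUniverse.hodge hHD hS 2).tensor (BettiUniverse.hodge hHD hT 2)).hodgeClasses (1 + 1)) =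
        Module.finrank ℚ (HodgeStructure.Hom (BettiUniverse.hodge hHD hS 2) (BettiUniverse.hodge hHD hT 2)) := by
      rw [show (1 : ℤ) + 1 = ((2 : ℕ) : ℤ) by norm_num]
      exact BettiUniverse.finrank_hodgeClasses_tensor_hodge_eq_finrank_hom hHD hS hT 2
    have hPeq : P = ((BettiUniverse.hodge hHD hS 2).tensor (BettiUniverse.hodge hHD hT 2)).hodgeClasses (1 + 1) :=
      Submodule.eq_of_le_of_finrank_le hPle (by rw [hHrank, hPrank]; exact h22)
    have ht' : t ∈ P := by
      rw [hPeq, show (1 : ℤ) + 1 = 2 by norm_num]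
      exact ht
    rw [hP] at ht'
    obtain ⟨w, rfl⟩ := ht'
    clear ht
    induction w using TensorProduct.induction_on with
    | zero => rw [map_zero, map_zero, map_zero]; exact Submodule.zero_mem _
    | tmul p q =>
      rw [TensorProduct.mapIncl, TensorProduct.map_tmul, Submodule.subtype_apply, Submodule.subtype_apply]
      have hpq := BettiUniverse.ofRatClass_crossMap_tmul_mem_algebraicClasses hS hT ((BettiUniverse.mem_hodgeClasses_hodge_two_iff_ofRatClass_mem_algebraicClasses_one hHD hS _).1 p.2)
        ((BettiUniverse.mem_hodgeClasses_hodge_two_iff_ofRatClass_mem_algebraicClasses_one hHD hT _).1 q.2)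
      exact hpq
    | add x y hx hy => rw [map_add, map_add, map_add]; exact Submodule.add_mem _ hx hy

/-- **`HC(S ⊗ T)` for a surface and a threefold with `Hom_HS(H¹(S), H³(T)(1)) = 0` and `dim_ℚ Hom_HS(H²(S), H²(T)) ≤ ρ(S)ρ(T)`, granted Fulton's pull-back lemma `hF`** (g27-#11 / g28-#1
without the condition `Hom_HS(H¹S, H¹T) = 0`). [cite: VoisinHodgeI2002, §11.3.3 Lemma 11.41, p. 287, Thm. 11.30 and §6.2.3 Thm. 6.25] [cite: Deligne2000, §1] [cite: Fulton1998, §19.1 Prop. 19.1.2 and Cor. 19.2 (b)] -/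
theorem BettiUniverse.hodgeConjectureFor_surface_tensor_threefold_of_hom_of_fulton (hF : fulton1998_map_mem_algebraicClasses) (hHD : exists_isReal_hodgeModel) (hS : IsSmoothProjective 2 S)
    (hT : IsSmoothProjective 3 T) (hST : IsSmoothProjective 5 (S ⊗ T))
    (h13 : Subsingleton (HodgeStructure.Hom (BettiUniverse.hodge hHD hS 1) (((BettiUniverse.hodge hHD hT 3).tateTwist 1).cast (by norm_num))))
    (h22 : Module.finrank ℚ (HodgeStructure.Hom (BettiUniverse.hodge hHD hS 2) (BettiUniverse.hodge hHD hT 2)) ≤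
      Module.finrank ℚ ↥((BettiUniverse.hodge hHD hS 2).hodgeClasses 1) * Module.finrank ℚ ↥((BettiUniverse.hodge hHD hT 2).hodgeClasses 1)) :
    HodgeConjectureFor 5 (S ⊗ T) :=
  BettiUniverse.hodgeConjectureFor_surface_tensor_threefold_of_hom_of_cupProduct hHD hS hT hST (fun _ _ hx hy ↦ cupProduct_algebraicClasses_of_fulton1998 hF hST hx hy) h13 h22

/-! ### An abelian surface times an abelian threefold: unconditional -/

/-- **`HC(A × B)` for an abelian SURFACE `A` and an abelian THREEFOLD `B` with `Hom_HS(H¹(A), H³(B)(1)) = 0` and `dim_ℚ Hom_HS(H²(A), H²(B)) ≤ ρ(A)ρ(B)` — UNCONDITIONALLY**: on the abelian variety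
`A × B` the cup product of algebraic classes is algebraic (the tree's `AbelianVariety.cupProduct_mem_algebraicClasses`, Voisin II Prop. 9.20 via translations), so no Fulton hypothesis is needed.
[cite: VoisinHodgeI2002, §11.3.3 Lemma 11.41, p. 287, Thm. 11.30 and §6.2.3 Thm. 6.25] [cite: VoisinHodgeII2003, §9.2.2 Prop. 9.20–9.21] [cite: Deligne2000, §1] -/
theorem AbelianVariety.hodgeConjectureFor_prod_surface_threefold_of_hom (A B : Motives.AbelianVariety ℂ) (hHD : exists_isReal_hodgeModel) (hA : IsSmoothProjective 2 A.X) (hB : IsSmoothProjective 3 B.X)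
    (hAB : IsSmoothProjective 5 (A.X ⊗ B.X)) (h13 : Subsingleton (HodgeStructure.Hom (BettiUniverse.hodge hHD hA 1) (((BettiUniverse.hodge hHD hB 3).tateTwist 1).cast (by norm_num))))
    (h22 : Module.finrank ℚ (HodgeStructure.Hom (BettiUniverse.hodge hHD hA 2) (BettiUniverse.hodge hHD hB 2)) ≤
      Module.finrank ℚ ↥((BettiUniverse.hodge hHD hA 2).hodgeClasses 1) * Module.finrank ℚ ↥((BettiUniverse.hodge hHD hB 2).hodgeClasses 1)) :
    HodgeConjectureFor 5 (A.X ⊗ B.X) :=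
  BettiUniverse.hodgeConjectureFor_surface_tensor_threefold_of_hom_of_cupProduct hHD hA hB hAB (fun _ _ hx hy ↦ AbelianVariety.cupProduct_mem_algebraicClasses (A.prod B) hx hy) h13 h22

/-- **`HC(S ⊗ T)` if `Hom_HS(H¹(S), H³(T)(1)) = 0` and `p_g(S) = 0`, granted `hF`** (`H²(S)` of pure type `(1,1)` forces `dim Hom_HS(H²S, H²T) = ρ(S)ρ(T)`; the irregularities of `S`, `T` are arbitrary).
[cite: VoisinHodgeI2002, §11.3.3 Lemma 11.41, p. 287, Thm. 11.30 and §6.2.3 Thm. 6.25] [cite: DeligneHodgeII1971, 2.1.13] [cite: Deligne2000, §1] [cite: Fulton1998, §19.1 Prop. 19.1.2 and Cor. 19.2 (b)] -/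
theorem BettiUniverse.hodgeConjectureFor_surface_tensor_threefold_of_pg_zero_of_hom_of_fulton (hF : fulton1998_map_mem_algebraicClasses) (hHD : exists_isReal_hodgeModel)
    (hS : IsSmoothProjective 2 S) (hT : IsSmoothProjective 3 T) (hST : IsSmoothProjective 5 (S ⊗ T)) (hpg : (BettiUniverse.hodge hHD hS 2).hodgeNumber 2 0 = 0)
    (h13 : Subsingleton (HodgeStructure.Hom (BettiUniverse.hodge hHD hS 1) (((BettiUniverse.hodge hHD hT 3).tateTwist 1).cast (by norm_num)))) : HodgeConjectureFor 5 (S ⊗ T) := by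
  haveI : HodgeTensorFacts.{0, 0} := hodgeTensorFacts_holds
  haveI := BettiUniverse.finite hS 2
  haveI := BettiUniverse.finite hT 2
  refine BettiUniverse.hodgeConjectureFor_surface_tensor_threefold_of_hom_of_fulton hF hHD hS hT hST h13 (le_of_eq ?_)
  have htop : (BettiUniverse.hodge hHD hS 2).hodgeClasses 1 = ⊤ := (BettiUniverse.hodgeClasses_hodge_two_eq_top_iff hHD hS).2 hpg
  have e := BettiUniverse.finrank_hodgeClasses_tensor_hodge_of_hodgeClasses_eq_top_left hHD hS hT (i := 2) (a := 1) (by norm_num) htop 2 1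
  rw [show (1 : ℤ) + 1 = ((2 : ℕ) : ℤ) by norm_num] at e
  rw [← BettiUniverse.finrank_hodgeClasses_tensor_hodge_eq_finrank_hom hHD hS hT 2, e, htop, finrank_top]

/-- **`HC(S ⊗ T)` if `Hom_HS(H¹(S), H³(T)(1)) = 0` and `h^{2,0}(T) = 0`, granted `hF`** (the mirror: `H²(T)` of pure type `(1,1)`). [cite: VoisinHodgeI2002, §11.3.3 Lemma 11.41, p. 287, Thm. 11.30 and §6.2.3 Thm. 6.25]
[cite: DeligneHodgeII1971, 2.1.13] [cite: Deligne2000, §1] [cite: Fulton1998, §19.1 Prop. 19.1.2 and Cor. 19.2 (b)] -/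
theorem BettiUniverse.hodgeConjectureFor_surface_tensor_threefold_of_h20_zero_of_hom_of_fulton (hF : fulton1998_map_mem_algebraicClasses) (hHD : exists_isReal_hodgeModel)
    (hS : IsSmoothProjective 2 S) (hT : IsSmoothProjective 3 T) (hST : IsSmoothProjective 5 (S ⊗ T)) (h20 : (BettiUniverse.hodge hHD hT 2).hodgeNumber 2 0 = 0)
    (h13 : Subsingleton (HodgeStructure.Hom (BettiUniverse.hodge hHD hS 1) (((BettiUniverse.hodge hHD hT 3).tateTwist 1).cast (by norm_num)))) : HodgeConjectureFor 5 (S ⊗ T) := by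
  haveI : HodgeTensorFacts.{0, 0} := hodgeTensorFacts_holds
  haveI := BettiUniverse.finite hS 2
  haveI := BettiUniverse.finite hT 2
  refine BettiUniverse.hodgeConjectureFor_surface_tensor_threefold_of_hom_of_fulton hF hHD hS hT hST h13 (le_of_eq ?_)
  have htop : (BettiUniverse.hodge hHD hT 2).hodgeClasses 1 = ⊤ := (BettiUniverse.hodgeClasses_hodge_two_eq_top_iff hHD hT).2 h20
  have e := BettiUniverse.finrank_hodgeClasses_tensor_hodge_of_hodgeClasses_eq_top_right hHD hS hT 2 (j := 2) (a := 1) (by norm_num) htop 1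
  rw [show (1 : ℤ) + 1 = ((2 : ℕ) : ℤ) by norm_num] at e
  rw [← BettiUniverse.finrank_hodgeClasses_tensor_hodge_eq_finrank_hom hHD hS hT 2, e, htop, finrank_top]

end Literature.AlgebraicGeometry.HodgeTheory

end
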